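import Mathlib.Analysis.Calculus.Deriv.MeanValue
import Mathlib.Analysis.SpecialFunctions.ExpDeriv
import Mathlib.MeasureTheory.Measure.OpenPos
import Literature.Barriers.AtomisticToContinuum.ShockFormationEnergyIdentity
import HarnessLib

/-!
# Sideris 1985, Theorem 1 — the local energy estimate on a backward cone

Support file 3 for the discharge of
`Literature.Barriers.AtomisticToContinuum.ShockFormationBarrier` (Sideris, Comm. Math. Phys.
101 (1985), Thm. 1): the weighted local energy
`E(t) = ∫ w(t, x) e(t, x) dx` (`PolytropicEuler.coneEnergy`; `w = coneWeight x₀ r₀ σ' t` the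
`C¹` cut-off of the backward cone `‖x - x₀‖ < r₀ - σ' t`, `e` the symmetrised energy density
relative to the rest state `(ρ̄, 0, S̄)`) of a `C¹` solution of the polytropic Euler system
(1.1 a–d) satisfies, as long as `‖u‖ + c ≤ σ'` on the cone slice,

`E'(t) ≤ (γ + 1) · sup |div u| · E(t)`

(`integral_deriv_coneIntegrand_le`): differentiate under the integral sign, insert the pointwise
identity `∂ₜe + div ((e + 2(p - p̄)) u) = (div u)(…)` of `ShockFormationEnergyIdentity`,
integrate the divergence by parts against the weight (no boundary terms: `w(t, ·)` is compactly
supported), and use the sign `∂ₜw · e + ⟪∇w, (e + 2(p - p̄)) u⟫ ≤ 0` given by flux domination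
(`energyFlux_domination`) — the smooth-cut-off form of the classical estimate "flux through the
mantle of a backward characteristic cone has a sign" (Sideris 1984, Proposition; John, *PDE*,
Ch. 5 §3). Consequences: `E ≡ 0` on an interval where it starts at `0` (Grönwall in the form
`t ↦ e^{-Ct} E(t)` nonincreasing), and `E(t) = 0` forces the rest state on the open cone slice.

## Mathlib search

`antitoneOn_of_deriv_nonpos`, `integral_eq_zero_iff_of_nonneg`, `Continuous.ae_eq_iff_eq`
(Lebesgue measure is positive on open sets), and the tree's whole-space integration by parts
`integral_mul_divergence_add_eq_zero_left` (`WholeSpaceIBP`), parametric integrals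
`continuousOn_integral_of_support_subset` (`SpaceTimeCalculus`),
`hasDerivAt_integral_of_contDiffOn` (`SpaceTimeCalculusC1`). No definitions in this file.

## References

* T. C. Sideris, Comm. Math. Phys. 101 (1985) 475–485, §1 Proposition p. 476.
* T. C. Sideris, Arch. Rational Mech. Anal. 86 (1984) 369–381 (local energy estimates).
* F. John, *Partial Differential Equations*, 4th ed. (1982), Ch. 5 §3.
-/

noncomputable section

open Set Function Filter MeasureTheory Metric
open scoped RealInnerProductSpace Topology

namespace Literature.Barriers.AtomisticToContinuum.PolytropicEuler

open Literature.Analysis.FluidPDE Literature.Analysis.FluidPDE.VectorCalculus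

/-! ### A Grönwall-type vanishing lemma -/

/-- **Vanishing under a linear differential inequality.** If `f ≥ 0` is continuous on `[a, b]`,
`f a = 0`, and `f' ≤ C f` on `(a, b)`, then `f ≡ 0` on `[a, b]` (`t ↦ e^{-Ct} f(t)` is
nonincreasing). [folklore] -/
theorem eq_zero_of_deriv_le_mul {f f' : ℝ → ℝ} {a b C : ℝ} (hf : ContinuousOn f (Icc a b))
    (hd : ∀ t ∈ Ioo a b, HasDerivAt f (f' t) t) (hle : ∀ t ∈ Ioo a b, f' t ≤ C * f t)
    (hnn : ∀ t ∈ Icc a b, 0 ≤ f t) (ha : f a = 0) : ∀ t ∈ Icc a b, f t = 0 := by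
  intro t ht
  set g : ℝ → ℝ := fun s => Real.exp (-(C * s)) * f s with hg
  have hgc : ContinuousOn g (Icc a b) :=
    ((Real.continuous_exp.comp (continuous_const.mul continuous_id).neg).continuousOn).mul hf
  have hgd : ∀ s ∈ Ioo a b,
      HasDerivAt g (Real.exp (-(C * s)) * (-C) * f s + Real.exp (-(C * s)) * f' s) s := by
    intro s hs
    have h1 : HasDerivAt (fun r => Real.exp (-(C * r))) (Real.exp (-(C * s)) * (-C)) s := by
      have := ((hasDerivAt_id s).const_mul C).neg.exp
      simpa using this
    exact h1.mul (hd s hs)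
  have hanti : AntitoneOn g (Icc a b) := by
    refine antitoneOn_of_deriv_nonpos (convex_Icc a b) hgc ?_ ?_
    · rw [interior_Icc]
      exact fun s hs => (hgd s hs).differentiableAt.differentiableWithinAt
    · rw [interior_Icc]
      intro s hs
      rw [(hgd s hs).deriv]
      have hexp : 0 < Real.exp (-(C * s)) := Real.exp_pos _
      nlinarith [hle s hs, hexp]
  have hgt : g t ≤ g a := hanti (left_mem_Icc.2 (ht.1.trans ht.2)) ht ht.1
  have hga : g a = 0 := by simp [hg, ha]
  have hft : f t ≤ 0 := by
    have hexp : 0 < Real.exp (-(C * t)) := Real.exp_pos _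
    have : Real.exp (-(C * t)) * f t ≤ 0 := by rw [hga] at hgt; exact hgt
    nlinarith
  exact le_antisymm hft (hnn t ht)

/-! ### The weighted energy on a backward cone: regularity -/

section Cone

variable {A γ ρbar Sbar : ℝ} {ρ : ℝ → E3 → ℝ} {u : ℝ → E3 → E3} {S : ℝ → E3 → ℝ}
variable {x₀ : E3} {r₀ σ' : ℝ}

/-- The integrand `w(t, x) e(t, x)` of the cone energy is jointly `C¹` on `[0, ∞) × ℝ³`. [folklore] -/
theorem contDiffOn_coneIntegrand (h : IsPolytropicC1Solution A γ (Ici 0) ρ u S) (hA : 0 < A)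
    (hγ : 0 < γ) :
    ContDiffOn ℝ 1 (uncurry fun t x => coneWeight x₀ r₀ σ' t x *
      energyDensity A γ ρbar Sbar (ρ t x) (u t x) (S t x)) (Ici 0 ×ˢ univ) :=
  (contDiff_uncurry_coneWeight x₀ r₀ σ').contDiffOn.mul (h.contDiffOn_energyDensity hA hγ.ne' ρbar Sbar)

/-- Off the ball `closedBall x₀ r₀` the integrand vanishes for `0 ≤ σ' t ≤ r₀`. [folklore] -/
theorem coneIntegrand_eq_zero_of_notMem (hσ' : 0 ≤ σ') {t : ℝ} (ht : 0 ≤ t) (htr : σ' * t ≤ r₀)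
    {x : E3} (hx : x ∉ closedBall x₀ r₀) :
    coneWeight x₀ r₀ σ' t x * energyDensity A γ ρbar Sbar (ρ t x) (u t x) (S t x) = 0 := by
  rw [coneWeight_eq_zero_of_notMem (by linarith) (mul_nonneg hσ' ht) hx, zero_mul]

/-- **Continuity of the cone energy** on `[0, T]`, `σ' T ≤ r₀`. [folklore] -/
theorem continuousOn_coneEnergy (h : IsPolytropicC1Solution A γ (Ici 0) ρ u S) (hA : 0 < A)
    (hγ : 0 < γ) (hσ' : 0 ≤ σ') {T : ℝ} (hT : σ' * T ≤ r₀) :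
    ContinuousOn (coneEnergy A γ ρbar Sbar ρ u S x₀ r₀ σ') (Icc 0 T) := by
  refine continuousOn_integral_of_support_subset (μ := volume) (isCompact_closedBall x₀ r₀)
    ((contDiffOn_coneIntegrand h hA hγ).continuousOn.mono
      (prod_mono Icc_subset_Ici_self Subset.rfl)) ?_
  intro t ht x hx
  exact coneIntegrand_eq_zero_of_notMem hσ' ht.1 ((mul_le_mul_of_nonneg_left ht.2 hσ').trans hT) hx

/-- **Differentiation of the cone energy under the integral sign** at interior times
`t ∈ (0, T)`, `σ' T ≤ r₀`. [folklore] -/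
theorem hasDerivAt_coneEnergy (h : IsPolytropicC1Solution A γ (Ici 0) ρ u S) (hA : 0 < A)
    (hγ : 0 < γ) (hσ' : 0 ≤ σ') {T t : ℝ} (hT : σ' * T ≤ r₀) (ht : t ∈ Ioo 0 T) :
    HasDerivAt (coneEnergy A γ ρbar Sbar ρ u S x₀ r₀ σ')
      (∫ x, deriv (fun s => coneWeight x₀ r₀ σ' s x *
        energyDensity A γ ρbar Sbar (ρ s x) (u s x) (S s x)) t) t := by
  refine hasDerivAt_integral_of_contDiffOn (μ := volume) isOpen_Ioo
    ((contDiffOn_coneIntegrand h hA hγ).mono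
      (prod_mono (fun s (hs : s ∈ Ioo 0 T) => mem_Ici.2 hs.1.le) Subset.rfl))
    (isCompact_closedBall x₀ r₀) ?_ ht
  intro s hs x hx
  exact coneIntegrand_eq_zero_of_notMem hσ' hs.1.le
    ((mul_le_mul_of_nonneg_left hs.2.le hσ').trans hT) hx

/-- The cone energy is nonnegative. [folklore] -/
theorem coneEnergy_nonneg (h : IsPolytropicC1Solution A γ (Ici 0) ρ u S) (hA : 0 < A)
    (hγ : 0 < γ) {t : ℝ} (ht : 0 ≤ t) : 0 ≤ coneEnergy A γ ρbar Sbar ρ u S x₀ r₀ σ' t :=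
  integral_nonneg fun x => mul_nonneg (coneWeight_nonneg x₀ r₀ σ' t x)
    (energyDensity_nonneg _ _ hA hγ (h.density_pos t ht x))

/-- **The cone energy vanishes when the slice is at rest**: if `(ρ, u, S)(t, ·) = (ρ̄, 0, S̄)` on
the closed ball `‖x - x₀‖ ≤ r₀ - σ' t` (`0 ≤ r₀ - σ' t`), then `E(t) = 0`. [folklore] -/
theorem coneEnergy_eq_zero_of_rest {t : ℝ} (htr : 0 ≤ r₀ - σ' * t)
    (hrest : ∀ x, ‖x - x₀‖ ≤ r₀ - σ' * t → ρ t x = ρbar ∧ u t x = 0 ∧ S t x = Sbar) :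
    coneEnergy A γ ρbar Sbar ρ u S x₀ r₀ σ' t = 0 := by
  refine integral_eq_zero_of_ae (Eventually.of_forall fun x => ?_)
  by_cases hx : ‖x - x₀‖ ≤ r₀ - σ' * t
  · obtain ⟨h1, h2, h3⟩ := hrest x hx
    simp [h1, h2, h3, energyDensity_rest]
  · simp [coneWeight_eq_zero htr (le_of_lt (not_le.1 hx))]

/-- **Vanishing cone energy forces the rest state on the open cone slice**: if `E(t) = 0`,
`t ≥ 0`, then `(ρ, u, S)(t, x) = (ρ̄, 0, S̄)` for `‖x - x₀‖ < r₀ - σ' t` (the integrand is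
continuous, nonnegative, and positive wherever `w > 0` and `e > 0`). [folklore] -/
theorem rest_of_coneEnergy_eq_zero (h : IsPolytropicC1Solution A γ (Ici 0) ρ u S) (hA : 0 < A)
    (hγ : 0 < γ) (hρbar : 0 < ρbar) (hσ' : 0 ≤ σ') {t : ℝ} (ht : 0 ≤ t) (htr : σ' * t ≤ r₀)
    (hE : coneEnergy A γ ρbar Sbar ρ u S x₀ r₀ σ' t = 0) {x : E3} (hx : ‖x - x₀‖ < r₀ - σ' * t) :
    ρ t x = ρbar ∧ u t x = 0 ∧ S t x = Sbar := by
  set Φ : E3 → ℝ := fun y => coneWeight x₀ r₀ σ' t y *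
    energyDensity A γ ρbar Sbar (ρ t y) (u t y) (S t y) with hΦ
  have hcont : Continuous Φ :=
    (contDiff_slice_of_contDiffOn (contDiffOn_coneIntegrand (x₀ := x₀) (r₀ := r₀) (σ' := σ')
      (ρbar := ρbar) (Sbar := Sbar) h hA hγ) (mem_Ici.2 ht)).continuous
  have hnn : 0 ≤ Φ := fun y => mul_nonneg (coneWeight_nonneg x₀ r₀ σ' t y)
    (energyDensity_nonneg _ _ hA hγ (h.density_pos t ht y))
  have hint : Integrable Φ := hcont.integrable_of_hasCompactSupport
    (HasCompactSupport.intro (isCompact_closedBall x₀ r₀)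
      fun y hy => coneIntegrand_eq_zero_of_notMem hσ' ht htr hy)
  have hae : Φ =ᵐ[volume] 0 := (integral_eq_zero_iff_of_nonneg hnn hint).1 hE
  have hzero : Φ = 0 := (hcont.ae_eq_iff_eq volume continuous_const).1 hae
  have hΦx : Φ x = 0 := by rw [hzero]; rfl
  have hw : 0 < coneWeight x₀ r₀ σ' t x := coneWeight_pos hx
  have he : energyDensity A γ ρbar Sbar (ρ t x) (u t x) (S t x) = 0 := by
    rcases mul_eq_zero.1 hΦx with h1 | h1
    · exact absurd h1 hw.ne'
    · exact h1
  exact eq_of_energyDensity_eq_zero hA hγ (h.density_pos t ht x) hρbar he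

/-! ### The local energy inequality -/

/-- The remainder of the energy identity is dominated by the energy:
`(γ + 1)(p - p̄)²/(γ p) + (S - S̄)² ≤ (γ + 1) e`. [folklore] -/
theorem remainder_le_mul_energyDensity {ρ' s : ℝ} (v : E3) (hγ : 0 ≤ γ) (hρ' : 0 ≤ ρ') :
    (γ + 1) * (polytropicPressure A γ ρ' s - polytropicPressure A γ ρbar Sbar) ^ 2 /
          (γ * polytropicPressure A γ ρ' s) + (s - Sbar) ^ 2 ≤
      (γ + 1) * energyDensity A γ ρbar Sbar ρ' v s := by
  have h1 : 0 ≤ (γ + 1) * (ρ' * ‖v‖ ^ 2) := by positivity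
  have h2 : 0 ≤ γ * (s - Sbar) ^ 2 := by positivity
  have key : (γ + 1) * energyDensity A γ ρbar Sbar ρ' v s -
      ((γ + 1) * (polytropicPressure A γ ρ' s - polytropicPressure A γ ρbar Sbar) ^ 2 /
          (γ * polytropicPressure A γ ρ' s) + (s - Sbar) ^ 2) =
        (γ + 1) * (ρ' * ‖v‖ ^ 2) + γ * (s - Sbar) ^ 2 := by
    unfold energyDensity
    ring
  linarith

/-- **The local energy inequality on a backward cone.** Let `t > 0` with `σ' t < r₀`, and
suppose that on the cone slice `‖x - x₀‖ ≤ r₀ - σ' t` the characteristic speeds are bounded by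
the cone speed, `‖u‖ + c(ρ, S) ≤ σ'`, and `|div u| ≤ M` on `closedBall x₀ r₀`. Then
`∫ ∂ₜ(w e)(t, x) dx ≤ (γ + 1) M E(t)`: by the energy identity
`∂ₜ(w e) = (∂ₜw) e - w div F + w (div u) R` with `F = (e + 2(p - p̄)) u`; integrating by parts,
`-∫ w div F = ∫ ⟪F, ∇w⟫`, and `(∂ₜw) e + ⟪F, ∇w⟫ = 4 min(q, 0) (σ' r e + (e + 2(p - p̄)) ⟪x - x₀, u⟫) ≤ 0`
(`r = r₀ - σ' t`, flux domination), while `w (div u) R ≤ (γ + 1) M w e`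
(Sideris 1984, Proposition; John, *PDE*, Ch. 5 §3). [folklore] -/
theorem integral_deriv_coneIntegrand_le (h : IsPolytropicC1Solution A γ (Ici 0) ρ u S)
    (hA : 0 < A) (hγ : 0 < γ) (hσ' : 0 < σ') {t M : ℝ} (ht : 0 < t) (htr : σ' * t < r₀)
    (hspeed : ∀ x, ‖x - x₀‖ ≤ r₀ - σ' * t → ‖u t x‖ + soundSpeed A γ (ρ t x) (S t x) ≤ σ')
    (hM : ∀ x ∈ closedBall x₀ r₀, |divergence (u t) x| ≤ M) :
    ∫ x, deriv (fun s => coneWeight x₀ r₀ σ' s x *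
        energyDensity A γ ρbar Sbar (ρ s x) (u s x) (S s x)) t ≤
      (γ + 1) * M * coneEnergy A γ ρbar Sbar ρ u S x₀ r₀ σ' t := by
  have ht' : t ∈ Ici (0 : ℝ) := ht.le
  have hr : 0 < r₀ - σ' * t := by linarith
  -- the slices at time `t`
  set w : E3 → ℝ := coneWeight x₀ r₀ σ' t with hw_def
  set wt : E3 → ℝ := fun y =>
    2 * min (‖y - x₀‖ ^ 2 - (r₀ - σ' * t) ^ 2) 0 * (2 * σ' * (r₀ - σ' * t)) with hwt_def
  set e : E3 → ℝ := fun y => energyDensity A γ ρbar Sbar (ρ t y) (u t y) (S t y) with he_def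
  set g : E3 → ℝ := fun y => energyFluxFactor A γ ρbar Sbar (ρ t y) (u t y) (S t y) with hg_def
  set Fl : E3 → E3 := fun y => g y • u t y with hFl_def
  set δ : E3 → ℝ := fun y => divergence (u t) y with hδ_def
  set R : E3 → ℝ := fun y => (γ + 1) *
      (polytropicPressure A γ (ρ t y) (S t y) - polytropicPressure A γ ρbar Sbar) ^ 2 /
        (γ * polytropicPressure A γ (ρ t y) (S t y)) + (S t y - Sbar) ^ 2 with hR_def
  -- regularity of the slices
  have hus : ContDiff ℝ 1 (u t) := contDiff_slice_of_contDiffOn h.contDiffOn_velocity ht'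
  have hSs : ContDiff ℝ 1 (S t) := contDiff_slice_of_contDiffOn h.contDiffOn_entropy ht'
  have hws : ContDiff ℝ 1 w :=
    contDiff_slice_of_contDiffOn (contDiff_uncurry_coneWeight x₀ r₀ σ').contDiffOn (mem_univ t)
  have hes : ContDiff ℝ 1 e :=
    contDiff_slice_of_contDiffOn (w := fun s y => energyDensity A γ ρbar Sbar (ρ s y) (u s y) (S s y))
      (h.contDiffOn_energyDensity hA hγ.ne' ρbar Sbar) ht'
  have hgs : ContDiff ℝ 1 g :=
    contDiff_slice_of_contDiffOn
      (w := fun s y => energyFluxFactor A γ ρbar Sbar (ρ s y) (u s y) (S s y))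
      (h.contDiffOn_energyFluxFactor hA hγ.ne' ρbar Sbar) ht'
  have hPs : ContDiff ℝ 1 (fun y => polytropicPressure A γ (ρ t y) (S t y)) :=
    contDiff_slice_of_contDiffOn (w := fun s y => polytropicPressure A γ (ρ s y) (S s y))
      h.contDiffOn_pressure ht'
  have hFls : ContDiff ℝ 1 Fl := hgs.smul hus
  have hwt_cont : Continuous wt := by
    refine (continuous_const.mul ((Continuous.sub ?_ continuous_const).min
      continuous_const)).mul continuous_const
    exact (continuous_id.sub continuous_const).norm.pow 2
  have hδ_cont : Continuous δ := continuous_divergence (hus.continuous_fderiv one_ne_zero)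
  have hdivFl_cont : Continuous (divergence Fl) :=
    continuous_divergence (hFls.continuous_fderiv one_ne_zero)
  have hR_cont : Continuous R := by
    have hP1 : Continuous fun y => polytropicPressure A γ (ρ t y) (S t y) := hPs.continuous
    have hne : ∀ y, γ * polytropicPressure A γ (ρ t y) (S t y) ≠ 0 := fun y =>
      mul_ne_zero hγ.ne' (polytropicPressure_pos hA (h.density_pos t ht' y)).ne'
    have h2 : Continuous fun y => (γ + 1) *
        (polytropicPressure A γ (ρ t y) (S t y) - polytropicPressure A γ ρbar Sbar) ^ 2 :=
      continuous_const.mul ((hP1.sub continuous_const).pow 2)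
    have h3 : Continuous fun y => γ * polytropicPressure A γ (ρ t y) (S t y) :=
      continuous_const.mul hP1
    have h4 : Continuous fun y => (γ + 1) *
        (polytropicPressure A γ (ρ t y) (S t y) - polytropicPressure A γ ρbar Sbar) ^ 2 /
          (γ * polytropicPressure A γ (ρ t y) (S t y)) := h2.div h3 hne
    have h5 : Continuous fun y => (S t y - Sbar) ^ 2 := (hSs.continuous.sub continuous_const).pow 2
    exact h4.add h5
  have hgradw_cont : Continuous (gradient w) := continuous_gradient_of_contDiff hws
  -- support: everything carries a factor vanishing off `closedBall x₀ r₀`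
  have hq_pos : ∀ y, y ∉ closedBall x₀ r₀ → 0 < ‖y - x₀‖ ^ 2 - (r₀ - σ' * t) ^ 2 := by
    intro y hy
    rw [mem_closedBall, dist_eq_norm, not_le] at hy
    have hσt : 0 ≤ σ' * t := (mul_pos hσ' ht).le
    nlinarith [norm_nonneg (y - x₀)]
  have hw_zero : ∀ y, y ∉ closedBall x₀ r₀ → w y = 0 := fun y hy =>
    coneWeight_eq_zero_of_notMem hr.le (mul_pos hσ' ht).le hy
  have hwt_zero : ∀ y, y ∉ closedBall x₀ r₀ → wt y = 0 := fun y hy => by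
    simp [hwt_def, min_eq_right (hq_pos y hy).le]
  have hgradw : ∀ y, gradient w y =
      (4 * min (‖y - x₀‖ ^ 2 - (r₀ - σ' * t) ^ 2) 0) • (y - x₀) := by
    intro y
    have h1 : (InnerProductSpace.toDual ℝ E3) (y - x₀) = innerSL ℝ (y - x₀) := by
      ext z
      simp [InnerProductSpace.toDual_apply_apply]
    rw [gradient, (hasFDerivAt_coneWeight_space x₀ r₀ σ' t y).fderiv, map_smul, ← h1,
      LinearIsometryEquiv.symm_apply_apply]
  have hgradw_zero : ∀ y, y ∉ closedBall x₀ r₀ → gradient w y = 0 := fun y hy => by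
    rw [hgradw y, min_eq_right (hq_pos y hy).le]
    simp
  have integrable_of : ∀ {f : E3 → ℝ}, Continuous f → (∀ y, y ∉ closedBall x₀ r₀ → f y = 0) →
      Integrable f := fun hf hz =>
    hf.integrable_of_hasCompactSupport (HasCompactSupport.intro (isCompact_closedBall x₀ r₀) hz)
  -- the pointwise time derivative of the integrand (energy identity)
  have hderiv : ∀ y, deriv (fun s => coneWeight x₀ r₀ σ' s y *
      energyDensity A γ ρbar Sbar (ρ s y) (u s y) (S s y)) t =
        (wt y * e y + ⟪Fl y, gradient w y⟫) - (w y * divergence Fl y + ⟪Fl y, gradient w y⟫) +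
          w y * (δ y * R y) := by
    intro y
    have hprod : HasDerivAt (fun s => coneWeight x₀ r₀ σ' s y *
        energyDensity A γ ρbar Sbar (ρ s y) (u s y) (S s y)) _ t :=
      (hasDerivAt_coneWeight_time x₀ r₀ σ' t y).mul
        (h.hasDerivAt_energyDensity hA hγ ρbar Sbar ht y)
    rw [hprod.deriv]
    simp only [hwt_def, he_def, hw_def, hFl_def, hg_def, hδ_def, hR_def]
    ring
  -- integrability of the three pieces
  have hI1 : Integrable fun y => wt y * e y + ⟪Fl y, gradient w y⟫ := by
    refine integrable_of ((hwt_cont.mul hes.continuous).add (hFls.continuous.inner hgradw_cont))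
      fun y hy => ?_
    simp [hwt_zero y hy, hgradw_zero y hy]
  have hI2a : Integrable fun y => w y * divergence Fl y :=
    integrable_of (hws.continuous.mul hdivFl_cont) fun y hy => by simp [hw_zero y hy]
  have hI2b : Integrable fun y => ⟪Fl y, gradient w y⟫ :=
    integrable_of (hFls.continuous.inner hgradw_cont) fun y hy => by simp [hgradw_zero y hy]
  have hI2 : Integrable fun y => w y * divergence Fl y + ⟪Fl y, gradient w y⟫ := hI2a.add hI2b
  have hI3 : Integrable fun y => w y * (δ y * R y) :=
    integrable_of (hws.continuous.mul (hδ_cont.mul hR_cont)) fun y hy => by simp [hw_zero y hy]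
  -- integration by parts: no boundary terms
  have hIBP : ∫ y, (w y * divergence Fl y + ⟪Fl y, gradient w y⟫) = 0 := by
    rw [integral_add hI2a hI2b]
    exact integral_mul_divergence_add_eq_zero_left hws hFls
      (HasCompactSupport.intro (isCompact_closedBall x₀ r₀) hw_zero)
  -- the boundary form has a sign (flux domination)
  have hsign : ∫ y, (wt y * e y + ⟪Fl y, gradient w y⟫) ≤ 0 := by
    refine integral_nonpos fun y => ?_
    have hform : wt y * e y + ⟪Fl y, gradient w y⟫ =
        4 * min (‖y - x₀‖ ^ 2 - (r₀ - σ' * t) ^ 2) 0 *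
          (σ' * (r₀ - σ' * t) * e y + ⟪y - x₀, u t y⟫ * g y) := by
      rw [hgradw y]
      simp only [hwt_def, hFl_def, inner_smul_left, inner_smul_right, RCLike.conj_to_real,
        real_inner_comm (u t y) (y - x₀)]
      ring
    rw [hform]
    by_cases hy : ‖y - x₀‖ ≤ r₀ - σ' * t
    · refine mul_nonpos_iff.2 (Or.inr ⟨?_, ?_⟩)
      · linarith [two_mul_min_zero_nonpos (‖y - x₀‖ ^ 2 - (r₀ - σ' * t) ^ 2)]
      · -- flux domination with `ξ = r⁻¹ (y - x₀)`
        have hξ : ‖(r₀ - σ' * t)⁻¹ • (y - x₀)‖ ≤ 1 := by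
          rw [norm_smul, Real.norm_eq_abs, abs_inv, abs_of_pos hr]
          rw [inv_mul_le_iff₀ hr]
          simpa using hy
        have hdom := energyFlux_domination (ρbar := ρbar) (Sbar := Sbar) hA hγ
          (h.density_pos t ht' y) hξ (hspeed y hy)
        rw [inner_smul_left, RCLike.conj_to_real] at hdom
        have hexp : σ' * (r₀ - σ' * t) * e y + ⟪y - x₀, u t y⟫ * g y =
            (r₀ - σ' * t) * (σ' * e y + (r₀ - σ' * t)⁻¹ * ⟪y - x₀, u t y⟫ * g y) := by
          field_simp
        rw [hexp]
        exact mul_nonneg hr.le hdom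
    · have hq : 0 ≤ ‖y - x₀‖ ^ 2 - (r₀ - σ' * t) ^ 2 := by
        rw [not_le] at hy
        nlinarith [norm_nonneg (y - x₀)]
      rw [min_eq_right hq]
      simp
  -- the remainder is dominated by the energy
  have hrem : ∫ y, w y * (δ y * R y) ≤
      (γ + 1) * M * coneEnergy A γ ρbar Sbar ρ u S x₀ r₀ σ' t := by
    have hpt : ∀ y, w y * (δ y * R y) ≤ (γ + 1) * M * (w y * e y) := by
      intro y
      by_cases hy : y ∈ closedBall x₀ r₀
      · have hw0 : 0 ≤ w y := coneWeight_nonneg x₀ r₀ σ' t y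
        have hR0 : 0 ≤ R y := by
          have hP := polytropicPressure_pos (γ := γ) (S := S t y) hA (h.density_pos t ht' y)
          have : 0 ≤ (γ + 1) *
              (polytropicPressure A γ (ρ t y) (S t y) - polytropicPressure A γ ρbar Sbar) ^ 2 /
                (γ * polytropicPressure A γ (ρ t y) (S t y)) + (S t y - Sbar) ^ 2 := by
            positivity
          exact this
        have hRe : R y ≤ (γ + 1) * e y :=
          remainder_le_mul_energyDensity (u t y) hγ.le (h.density_pos t ht' y).le
        have hδM : |δ y| ≤ M := hM y hy
        have h1 : δ y * R y ≤ M * ((γ + 1) * e y) :=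
          calc δ y * R y ≤ |δ y| * R y := by
                exact mul_le_mul_of_nonneg_right (le_abs_self _) hR0
            _ ≤ M * R y := mul_le_mul_of_nonneg_right hδM hR0
            _ ≤ M * ((γ + 1) * e y) :=
                mul_le_mul_of_nonneg_left hRe ((abs_nonneg _).trans hδM)
        calc w y * (δ y * R y) ≤ w y * (M * ((γ + 1) * e y)) :=
              mul_le_mul_of_nonneg_left h1 hw0
          _ = (γ + 1) * M * (w y * e y) := by ring
      · rw [hw_zero y hy]
        simp
    calc ∫ y, w y * (δ y * R y) ≤ ∫ y, (γ + 1) * M * (w y * e y) :=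
          integral_mono hI3 ((integrable_of (hws.continuous.mul hes.continuous)
            fun y hy => by simp [hw_zero y hy]).const_mul _) hpt
      _ = (γ + 1) * M * coneEnergy A γ ρbar Sbar ρ u S x₀ r₀ σ' t := by
          rw [integral_const_mul]
          rfl
  -- assemble
  calc ∫ x, deriv (fun s => coneWeight x₀ r₀ σ' s x *
          energyDensity A γ ρbar Sbar (ρ s x) (u s x) (S s x)) t
      = ∫ y, ((wt y * e y + ⟪Fl y, gradient w y⟫) -
          (w y * divergence Fl y + ⟪Fl y, gradient w y⟫) + w y * (δ y * R y)) :=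
        integral_congr_ae (Eventually.of_forall hderiv)
    _ = (∫ y, (wt y * e y + ⟪Fl y, gradient w y⟫)) -
          (∫ y, (w y * divergence Fl y + ⟪Fl y, gradient w y⟫)) + ∫ y, w y * (δ y * R y) := by
        rw [integral_add (f := fun y => (wt y * e y + ⟪Fl y, gradient w y⟫) -
            (w y * divergence Fl y + ⟪Fl y, gradient w y⟫)) (g := fun y => w y * (δ y * R y))
            (hI1.sub hI2) hI3, integral_sub hI1 hI2]
    _ ≤ 0 - 0 + (γ + 1) * M * coneEnergy A γ ρbar Sbar ρ u S x₀ r₀ σ' t := by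
        rw [hIBP]
        gcongr
    _ = (γ + 1) * M * coneEnergy A γ ρbar Sbar ρ u S x₀ r₀ σ' t := by ring

end Cone

end Literature.Barriers.AtomisticToContinuum.PolytropicEuler

end
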